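import Literature.Probability.RandomPlanarGeometry.ParaObservableFarField
import Literature.Probability.RandomPlanarGeometry.ObservableDiscretePassage
import HarnessLib

/-!
# The spin-1/3 observable martingale property passes to the scaling limit of the driving processes

Topic `Literature/Probability/RandomPlanarGeometry` (deterministic Loewner theory + abstract
probability; no lattice model); theorems only, no definition. Percolation (`κ = 6`) companion
of `ObservableDiscretePassage.lean` (FK observable) and `SpinObservableLimitPassage.lean` (spin
observable): the abstract passage `integral_cylinder_eq_zero_of_discreteMartingales`
(convergence in distribution of the driving processes + discrete observable martingales
approximating a bounded, jointly continuous path functional ⟹ cylinder identity of the limit)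
specialised to the time-limited spin-1/3 observable
`N^y_u(w) = (iy g_u'(iy)/(g_u(iy) - w_u))^{1/3}`, `u ≤ T(iy) = y²/9` (explicit expression,
literally the body of the percolation routes' `paraObservableProcess`), which is jointly
continuous and bounded by `2` (`continuous_paraObservable_min_cdhksTime`,
`norm_paraObservable_min_le`):

* `integral_paraObservableProcess_cylinder_eq_zero_of_forall_lt` — extension of the cylinder
  identity past the time horizon (the observable is frozen after `T(iy)`; dominated
  convergence as `t ↑ T(iy)`);
* `integral_paraObservableProcess_cylinder_eq_zero_of_discreteMartingales` — the cylinder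
  identity for a limit `(W, μ)` of driving processes from discrete observable martingale data
  at every scale (the shape `hD` consumed by `ParaObservableSLESix.lean`).

## References

* H. Duminil-Copin, *Divergence of the correlation length for critical planar FK percolation
  with `1 ≤ q ≤ 4` via parafermionic observables*, J. Phys. A 45 (2012) 494013
  (arXiv:1208.3787), p. 9.
* D. Chelkak, H. Duminil-Copin, C. Hongler, A. Kemppainen, S. Smirnov, *Convergence of Ising
  interfaces to Schramm's SLE curves*, C. R. Math. Acad. Sci. Paris 352 (2014), Thm. 3 and §3.
-/

noncomputable section

open Set Filter Topology Metric MeasureTheory Complex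
open scoped NNReal

namespace Literature.Probability.RandomPlanarGeometry

namespace Loewner

open Literature.Probability.Process

variable {Ω : Type*} {m : MeasurableSpace Ω} {W : ℝ≥0 → Ω → ℝ}

/-! ### The cylinder identity of the spin-1/3 observable from discrete martingales -/

section DiscretePassage

variable {μ : Measure Ω} [IsProbabilityMeasure μ]
  {Ω' : ℕ → Type*} {mΩ' : ∀ k, MeasurableSpace (Ω' k)} {P : ∀ k, Measure (Ω' k)}
  [∀ k, IsProbabilityMeasure (P k)]
  [MeasurableSpace C(ℝ≥0, ℝ)] [OpensMeasurableSpace C(ℝ≥0, ℝ)]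

/-- **Extension of the spin-1/3 cylinder identity past the time horizon.** For a
continuous-path process `W` on `(Ω, μ)` whose path map is a.e. measurable, `y > 0`, a time `s`
and a bounded continuous cylinder test function `ψ(W_S)`: if
`E_μ[(N^y_t(W) - N^y_s(W)) ψ(W_S)] = 0` for all `t` with `s < t < T(iy) = y²/9`, then the
identity holds for every `t ≥ s` — the time-limited observable is constant in `u ≥ T(iy)`,
continuous in `u` and bounded by `2`, so the case `t ≥ T(iy) > s` follows by letting
`t ↑ T(iy)` under the integral (dominated convergence). [folklore] -/
theorem integral_paraObservableProcess_cylinder_eq_zero_of_forall_lt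
    (hWc : ∀ ω, Continuous (W · ω))
    (hWm : AEMeasurable (fun ω ↦ (⟨fun r ↦ W r ω, hWc ω⟩ : C(ℝ≥0, ℝ))) μ)
    {y : ℝ} (hy : 0 < y) {s : ℝ≥0} {n : ℕ} (S : Fin n → ℝ≥0) {ψ : (Fin n → ℝ) → ℝ}
    (hψc : Continuous ψ) (hψ1 : ∀ v, |ψ v| ≤ 1)
    (h : ∀ t : ℝ≥0, s < t → t < cdhksTime y →
      ∫ ω, ((((I * y) * deriv (map (fun u ↦ W u ω) (min t (cdhksTime y))) (I * y) /
            (map (fun u ↦ W u ω) (min t (cdhksTime y)) (I * y) - ((W (min t (cdhksTime y)) ω : ℝ) : ℂ))) ^ ((3 : ℂ)⁻¹)) - (((I * y) * deriv (map (fun u ↦ W u ω) (min s (cdhksTime y))) (I * y) /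
                  (map (fun u ↦ W u ω) (min s (cdhksTime y)) (I * y) - ((W (min s (cdhksTime y)) ω : ℝ) : ℂ))) ^ ((3 : ℂ)⁻¹))) * (ψ (fun i ↦ W (S i) ω) : ℂ) ∂μ = 0)
    {t : ℝ≥0} (hst : s ≤ t) :
    ∫ ω, ((((I * y) * deriv (map (fun u ↦ W u ω) (min t (cdhksTime y))) (I * y) /
          (map (fun u ↦ W u ω) (min t (cdhksTime y)) (I * y) - ((W (min t (cdhksTime y)) ω : ℝ) : ℂ))) ^ ((3 : ℂ)⁻¹)) - (((I * y) * deriv (map (fun u ↦ W u ω) (min s (cdhksTime y))) (I * y) /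
                (map (fun u ↦ W u ω) (min s (cdhksTime y)) (I * y) - ((W (min s (cdhksTime y)) ω : ℝ) : ℂ))) ^ ((3 : ℂ)⁻¹))) * (ψ (fun i ↦ W (S i) ω) : ℂ) ∂μ = 0 := by
  -- the functional `N^y_u(w)` on path space, made opaque
  obtain ⟨N, hN⟩ : ∃ N : ℝ≥0 → C(ℝ≥0, ℝ) → ℂ,
      N = fun u (w : C(ℝ≥0, ℝ)) ↦ (((I * y) * deriv (map w (min u (cdhksTime y))) (I * y) /
            (map w (min u (cdhksTime y)) (I * y) - ((w (min u (cdhksTime y)) : ℝ) : ℂ))) ^ ((3 : ℂ)⁻¹)) := ⟨_, rfl⟩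
  have hNc : Continuous (Function.uncurry N) := by
    rw [hN]; exact continuous_paraObservable_min_cdhksTime hy
  have hNC : ∀ u w, ‖N u w‖ ≤ 2 := fun u w ↦ by
    rw [hN]; exact norm_paraObservable_min_le w.continuous hy u
  have hfreeze : ∀ u : ℝ≥0, cdhksTime y ≤ u → ∀ w, N u w = N (cdhksTime y) w := by
    intro u hu w
    rw [hN]
    simp only [min_eq_right hu, min_self]
  have hobs : ∀ u ω, (((I * y) * deriv (map (fun u ↦ W u ω) (min u (cdhksTime y))) (I * y) /
        (map (fun u ↦ W u ω) (min u (cdhksTime y)) (I * y) - ((W (min u (cdhksTime y)) ω : ℝ) : ℂ))) ^ ((3 : ℂ)⁻¹)) = N u ⟨fun r ↦ W r ω, hWc ω⟩ := by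
    intro u ω; rw [hN]; rfl
  simp only [hobs] at h ⊢
  clear hobs
  have hevalc : Continuous fun w : C(ℝ≥0, ℝ) ↦ (fun i ↦ w (S i) : Fin n → ℝ) :=
    continuous_pi fun i ↦ continuous_eval_const (S i)
  have hNt : ∀ u, Continuous fun w : C(ℝ≥0, ℝ) ↦ N u w := fun u ↦
    hNc.comp (continuous_const.prodMk continuous_id)
  have hNu : ∀ w, Continuous fun u : ℝ≥0 ↦ N u w := fun w ↦
    hNc.comp (continuous_id.prodMk continuous_const)
  rcases hst.eq_or_lt with rfl | hst'
  · simp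
  rcases lt_or_ge t (cdhksTime y) with htT | htT
  · exact h t hst' htT
  rcases le_or_gt (cdhksTime y) s with hsT | hsT
  · have h0 : ∀ ω, N t ⟨fun r ↦ W r ω, hWc ω⟩ - N s ⟨fun r ↦ W r ω, hWc ω⟩ = 0 := fun ω ↦ by
      rw [hfreeze t htT, hfreeze s hsT, sub_self]
    simp [h0]
  simp_rw [hfreeze t htT]
  -- approximate `T(iy)` from below by times `tm m ∈ (s, T(iy))`
  obtain ⟨tm, -, htm_mem, htm_lim⟩ := exists_seq_strictMono_tendsto' hsT
  have hm : ∀ m, ∫ ω, (N (tm m) ⟨fun r ↦ W r ω, hWc ω⟩ - N s ⟨fun r ↦ W r ω, hWc ω⟩) *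
      (ψ (fun i ↦ W (S i) ω) : ℂ) ∂μ = 0 :=
    fun m ↦ h (tm m) (htm_mem m).1 (htm_mem m).2
  have hψC : Continuous fun w : C(ℝ≥0, ℝ) ↦ (ψ (fun i ↦ w (S i)) : ℂ) :=
    continuous_ofReal.comp (hψc.comp hevalc)
  have hmeas : ∀ u : ℝ≥0, AEStronglyMeasurable (fun ω ↦ (N u ⟨fun r ↦ W r ω, hWc ω⟩ -
      N s ⟨fun r ↦ W r ω, hWc ω⟩) * (ψ (fun i ↦ W (S i) ω) : ℂ)) μ := fun u ↦ by
    have hc : Continuous fun w : C(ℝ≥0, ℝ) ↦ (N u w - N s w) * (ψ (fun i ↦ w (S i)) : ℂ) :=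
      ((hNt u).sub (hNt s)).mul hψC
    exact (hc.measurable.comp_aemeasurable hWm).aestronglyMeasurable
  have hbd : ∀ (u : ℝ≥0) ω, ‖(N u ⟨fun r ↦ W r ω, hWc ω⟩ - N s ⟨fun r ↦ W r ω, hWc ω⟩) *
      (ψ (fun i ↦ W (S i) ω) : ℂ)‖ ≤ 4 := fun u ω ↦ by
    rw [norm_mul, Complex.norm_real, Real.norm_eq_abs]
    have hu4 := hNC u ⟨fun r ↦ W r ω, hWc ω⟩
    have hs4 := hNC s ⟨fun r ↦ W r ω, hWc ω⟩
    have h1 : ‖N u ⟨fun r ↦ W r ω, hWc ω⟩ - N s ⟨fun r ↦ W r ω, hWc ω⟩‖ ≤ 4 :=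
      (norm_sub_le _ _).trans (by linarith)
    calc ‖N u ⟨fun r ↦ W r ω, hWc ω⟩ - N s ⟨fun r ↦ W r ω, hWc ω⟩‖ * |ψ fun i ↦ W (S i) ω|
        ≤ 4 * 1 := mul_le_mul h1 (hψ1 _) (abs_nonneg _) (by norm_num)
      _ = 4 := by norm_num
  have hlim : Tendsto (fun m ↦ ∫ ω, (N (tm m) ⟨fun r ↦ W r ω, hWc ω⟩ -
      N s ⟨fun r ↦ W r ω, hWc ω⟩) * (ψ (fun i ↦ W (S i) ω) : ℂ) ∂μ) atTop
      (𝓝 (∫ ω, (N (cdhksTime y) ⟨fun r ↦ W r ω, hWc ω⟩ - N s ⟨fun r ↦ W r ω, hWc ω⟩) *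
        (ψ (fun i ↦ W (S i) ω) : ℂ) ∂μ)) := by
    refine tendsto_integral_of_dominated_convergence (fun _ ↦ 4) (fun m ↦ hmeas _)
      (integrable_const _) (fun m ↦ ae_of_all _ fun ω ↦ hbd _ ω) (ae_of_all _ fun ω ↦ ?_)
    exact ((((hNu _).tendsto _).comp htm_lim).sub tendsto_const_nhds).mul tendsto_const_nhds
  have h0 : Tendsto (fun m ↦ ∫ ω, (N (tm m) ⟨fun r ↦ W r ω, hWc ω⟩ -
      N s ⟨fun r ↦ W r ω, hWc ω⟩) * (ψ (fun i ↦ W (S i) ω) : ℂ) ∂μ) atTop (𝓝 0) := by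
    simp_rw [hm]
    exact tendsto_const_nhds
  exact tendsto_nhds_unique hlim h0

/-- **The cylinder identity of the spin-1/3 observable from discrete observable martingales.**
Let the continuous-path driving processes `V k` on `(Ω' k, P k)` converge in distribution in
`C([0, ∞), ℝ)` to the continuous-path process `W` on `(Ω, μ)`, and let `y > 0`. Suppose that
for all `s < t < T(iy) = y²/9` there are a constant `C'` and null sequences `ε, Δ, η` such that
every scale `k` carries a discrete filtration `𝒢`, a complex `𝒢`-martingale `F` and
`𝒢`-stopping times `σ ≤ τ ≤ M` such that the driving values `V^k_u`, `u ≤ s`, are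
`𝒢_σ`-measurable, `‖F_σ‖, ‖F_τ‖ ≤ C'` a.e., and off an event of probability `≤ η_k` the
stopped values are within `ε_k` of the time-limited spin-1/3 observable `N^y_u(V^k)` at some
`u ∈ [s, s + Δ_k]`, resp. `[t, t + Δ_k]` (the discrete parafermionic observable martingale of
the explored domain and its convergence, uniformly over the slit domains, plus the capacity
overshoot of one lattice step). Then for ALL `s ≤ t`, all finite families of times `S ≤ s`
and all continuous `ψ` with `|ψ| ≤ 1`, `E_μ[(N^y_t(W) - N^y_s(W)) ψ(W_S)] = 0`. PROVED: the
abstract passage `integral_cylinder_eq_zero_of_discreteMartingales` with the jointly continuous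
functional `N^y`, bounded by `2`, for `s < t < T(iy)`, then
`integral_paraObservableProcess_cylinder_eq_zero_of_forall_lt`.
[cite: DuminilCopin2012Parafermion, p. 9] -/
theorem integral_paraObservableProcess_cylinder_eq_zero_of_discreteMartingales
    (hWc : ∀ ω, Continuous (W · ω))
    {V : ∀ k, ℝ≥0 → Ω' k → ℝ} (hVc : ∀ k ω, Continuous (V k · ω))
    (hlaw : TendstoInDistribution (fun k ω ↦ (⟨fun u ↦ V k u ω, hVc k ω⟩ : C(ℝ≥0, ℝ))) atTop
      (fun ω ↦ (⟨fun u ↦ W u ω, hWc ω⟩ : C(ℝ≥0, ℝ))) P μ)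
    {y : ℝ} (hy : 0 < y)
    (hD : ∀ s t : ℝ≥0, s < t → t < cdhksTime y →
      ∃ (C' : ℝ) (ε Δ η : ℕ → ℝ≥0), Tendsto ε atTop (𝓝 0) ∧ Tendsto Δ atTop (𝓝 0) ∧
        Tendsto η atTop (𝓝 0) ∧
        ∀ k, ∃ (𝒢 : Filtration ℕ (mΩ' k)) (F : ℕ → Ω' k → ℂ) (σ τ : Ω' k → WithTop ℕ)
          (hσ : IsStoppingTime 𝒢 σ) (M : ℕ) (bad : Set (Ω' k)),
          IsStoppingTime 𝒢 τ ∧ Martingale F 𝒢 (P k) ∧ σ ≤ τ ∧ (∀ ω, τ ω ≤ M) ∧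
          (∀ u, u ≤ s → Measurable[hσ.measurableSpace] (V k u)) ∧
          (∀ᵐ ω ∂P k, ‖stoppedValue F σ ω‖ ≤ C') ∧ (∀ᵐ ω ∂P k, ‖stoppedValue F τ ω‖ ≤ C') ∧
          MeasurableSet bad ∧ P k bad ≤ η k ∧
          ∀ᵐ ω ∂P k, ω ∉ bad →
            (∃ u ∈ Icc s (s + Δ k), ‖stoppedValue F σ ω - (((I * y) * deriv (map (fun u ↦ (V k) u ω) (min u (cdhksTime y))) (I * y) /
                  (map (fun u ↦ (V k) u ω) (min u (cdhksTime y)) (I * y) - (((V k) (min u (cdhksTime y)) ω : ℝ) : ℂ))) ^ ((3 : ℂ)⁻¹))‖ ≤ ε k) ∧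
            (∃ u ∈ Icc t (t + Δ k), ‖stoppedValue F τ ω - (((I * y) * deriv (map (fun u ↦ (V k) u ω) (min u (cdhksTime y))) (I * y) /
                  (map (fun u ↦ (V k) u ω) (min u (cdhksTime y)) (I * y) - (((V k) (min u (cdhksTime y)) ω : ℝ) : ℂ))) ^ ((3 : ℂ)⁻¹))‖ ≤ ε k)) :
    ∀ s t : ℝ≥0, s ≤ t → ∀ (n : ℕ) (S : Fin n → ℝ≥0), (∀ i, S i ≤ s) →
      ∀ ψ : (Fin n → ℝ) → ℝ, Continuous ψ → (∀ v, |ψ v| ≤ 1) →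
        ∫ ω, ((((I * y) * deriv (map (fun u ↦ W u ω) (min t (cdhksTime y))) (I * y) /
              (map (fun u ↦ W u ω) (min t (cdhksTime y)) (I * y) - ((W (min t (cdhksTime y)) ω : ℝ) : ℂ))) ^ ((3 : ℂ)⁻¹)) - (((I * y) * deriv (map (fun u ↦ W u ω) (min s (cdhksTime y))) (I * y) /
                    (map (fun u ↦ W u ω) (min s (cdhksTime y)) (I * y) - ((W (min s (cdhksTime y)) ω : ℝ) : ℂ))) ^ ((3 : ℂ)⁻¹))) * (ψ (fun i ↦ W (S i) ω) : ℂ) ∂μ = 0 := by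
  intro s t hst n S hS ψ hψc hψ1
  refine integral_paraObservableProcess_cylinder_eq_zero_of_forall_lt hWc hlaw.aemeasurable_limit
    hy S hψc hψ1 (fun t' hst' ht'T ↦ ?_) hst
  obtain ⟨C', ε, Δ, η, hε, hΔ, hη, hDk⟩ := hD s t' hst' ht'T
  -- the functional `N^y` on path space
  obtain ⟨N, hN⟩ : ∃ N : ℝ≥0 → C(ℝ≥0, ℝ) → ℂ,
      N = fun u (w : C(ℝ≥0, ℝ)) ↦ (((I * y) * deriv (map w (min u (cdhksTime y))) (I * y) /
            (map w (min u (cdhksTime y)) (I * y) - ((w (min u (cdhksTime y)) : ℝ) : ℂ))) ^ ((3 : ℂ)⁻¹)) := ⟨_, rfl⟩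
  have hNc : Continuous (Function.uncurry N) := by
    rw [hN]; exact continuous_paraObservable_min_cdhksTime hy
  have hNC : ∀ u w, ‖N u w‖ ≤ 2 := fun u w ↦ by
    rw [hN]; exact norm_paraObservable_min_le w.continuous hy u
  have hobs : ∀ u ω, (((I * y) * deriv (map (fun u ↦ W u ω) (min u (cdhksTime y))) (I * y) /
        (map (fun u ↦ W u ω) (min u (cdhksTime y)) (I * y) - ((W (min u (cdhksTime y)) ω : ℝ) : ℂ))) ^ ((3 : ℂ)⁻¹)) = N u ⟨fun r ↦ W r ω, hWc ω⟩ := by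
    intro u ω; rw [hN]; rfl
  have hobsV : ∀ k u ω, (((I * y) * deriv (map (fun u ↦ (V k) u ω) (min u (cdhksTime y))) (I * y) /
        (map (fun u ↦ (V k) u ω) (min u (cdhksTime y)) (I * y) - (((V k) (min u (cdhksTime y)) ω : ℝ) : ℂ))) ^ ((3 : ℂ)⁻¹)) = N u ⟨fun r ↦ V k r ω, hVc k ω⟩ := by
    intro k u ω; rw [hN]; rfl
  simp only [hobsV] at hDk
  simp only [hobs]
  exact integral_cylinder_eq_zero_of_discreteMartingales hWc hVc hlaw hNc hNC s t' hS hψc hψ1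
    hε hΔ hη hDk

end DiscretePassage

end Loewner

end Literature.Probability.RandomPlanarGeometry
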